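import Mathlib.Analysis.SpecialFunctions.Pow.Real
import Mathlib.Analysis.SpecialFunctions.Pow.Deriv
import Mathlib.Analysis.SpecialFunctions.Log.Deriv
import Mathlib.Analysis.Convex.SpecificFunctions.Basic
import Mathlib.Analysis.Convex.Slope
import Mathlib.Analysis.Calculus.Deriv.MeanValue
import HarnessLib

/-!
# The one-variable lemma behind the parallel-composition stability of `V4`

Support file for crux `stmt-CriticalPhenomena-4575` (`NoHeavyLowerTail`), seat `prim-nh-lead-4575` lead gen 134 (`--supports stmt-CriticalPhenomena-4575`;
memo `run/shared/lean/prim/prim-nh-lead-4575/FROM-prim-nh-lead-4575-g134-V4-PARALLEL-CLOSURE.md`, §2).  No definitions, no sorries, standard axioms.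

The two-piece lemma '`V4` is stable under gluing at `{s,a,b,c}` modulo the universal `(Q6)` law' (file `…SuperTerminalQuarticStable`) reduces,
after a Young–Hölder split of the coupling term `1 - a₁a₂` with conjugate exponents `k₁, k₂` (`t₁^{k₁} = t₂^{k₂} = t₁t₂`), to ONE-VARIABLE inequalities
with a real exponent `k ≥ 1`.  This file proves them:
* `chord_rpow` — for `k ≥ 1`, `0 ≤ t ≤ a < 1`: `(1 - t^k)(1 - a) ≤ (1 - a^k)(1 - t)` (the chord slope of the convex `x ↦ x^k` towards `1` is monotone; no calculus);
* `regionI` — for `k ≥ 1`, `E ≥ 1`, `0 ≤ t ≤ a < 1`: `(1 - t^k)(1 - a)^E ≤ (1 - a^k)(1 - t)^E`;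
* `P_nonpos` — for `1 ≤ k ≤ 4`, `0 ≤ x ≤ 1`: `3x - (k-1) - (2k+1)x^k + 3(k-1)x^{k+1} ≤ 0` (log-derivative argument; the quadratic `9x² - 3(k+2)x + (2k+1)` has
  discriminant `9k(k-4) ≤ 0`);
* `regionII` — for `1 ≤ k ≤ 4`, `0 < a ≤ t < 1`: `(1 - t^k)³ a^{k-1} (1-a)^{4-k} ≤ (1 - a^k)³ t^{k-1} (1-t)^{4-k}` (the function
  `3·log(1 - y^k) + (1-k)·log y + (k-4)·log(1-y)` is non-increasing on `(0,1)`: its derivative is `P(y)/(y(1-y)(1-y^k))`).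
-/

namespace Summit.CriticalPhenomena.PercolationContinuityZ3.Theorems.SuperTerminalQuarticOneSided

open Real Set

/-! ## Region I: chord slopes of `x ↦ x^k` -/

/-- For `k ≥ 1` and `0 ≤ t ≤ a < 1`: `(1 - t^k)/(1 - t) ≤ (1 - a^k)/(1 - a)` in cleared form.  (Secant slopes of the convex function
`x ↦ x^k` through the point `1` are monotone.) [folklore] -/
theorem chord_rpow {k t a : ℝ} (hk : 1 ≤ k) (ht : 0 ≤ t) (hta : t ≤ a) (ha : a < 1) :
    (1 - t ^ k) * (1 - a) ≤ (1 - a ^ k) * (1 - t) := by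
  have hconv := convexOn_rpow hk
  have ha0 : 0 ≤ a := ht.trans hta
  have hsec := hconv.secant_mono (a := 1) (x := t) (y := a) (by simp) (by simpa using ht) (by simpa using ha0)
    (ne_of_lt (lt_of_le_of_lt hta ha)) (ne_of_lt ha) hta
  -- hsec : (t^k - 1^k)/(t - 1) ≤ (a^k - 1^k)/(a - 1)
  simp only [Real.one_rpow] at hsec
  have h1 : (t ^ k - 1) / (t - 1) = (1 - t ^ k) / (1 - t) := by
    rw [← neg_sub 1 (t ^ k), ← neg_sub 1 t, neg_div_neg_eq]
  have h2 : (a ^ k - 1) / (a - 1) = (1 - a ^ k) / (1 - a) := by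
    rw [← neg_sub 1 (a ^ k), ← neg_sub 1 a, neg_div_neg_eq]
  rw [h1, h2] at hsec
  have hta' : 0 < 1 - t := by linarith
  have haa' : 0 < 1 - a := by linarith
  rw [div_le_div_iff₀ hta' haa'] at hsec
  linarith

/-- **Region I of the one-variable lemma.**  For `k ≥ 1`, `E ≥ 1` and `0 ≤ t ≤ a < 1`:
`(1 - t^k)·(1 - a)^E ≤ (1 - a^k)·(1 - t)^E`, i.e. `(1 - a^k)/(1 - a)^E` is non-decreasing. [this work] -/
theorem regionI {k E t a : ℝ} (hk : 1 ≤ k) (hE : 1 ≤ E) (ht : 0 ≤ t) (hta : t ≤ a) (ha : a < 1) :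
    (1 - t ^ k) * (1 - a) ^ E ≤ (1 - a ^ k) * (1 - t) ^ E := by
  have hc := chord_rpow hk ht hta ha
  have hta' : 0 < 1 - t := by linarith
  have haa' : 0 < 1 - a := by linarith
  have htk : t ^ k ≤ 1 := Real.rpow_le_one ht (by linarith) (by linarith)
  have hak : a ^ k ≤ 1 := Real.rpow_le_one (ht.trans hta) ha.le (by linarith)
  -- split `(1-a)^E = (1-a) * (1-a)^(E-1)` and compare the second factors
  have eA : (1 - a) ^ E = (1 - a) * (1 - a) ^ (E - 1) := by
    rw [← Real.rpow_one_add' haa'.le (by linarith)]; ring_nf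
  have eT : (1 - t) ^ E = (1 - t) * (1 - t) ^ (E - 1) := by
    rw [← Real.rpow_one_add' hta'.le (by linarith)]; ring_nf
  have hmono : (1 - a) ^ (E - 1) ≤ (1 - t) ^ (E - 1) :=
    Real.rpow_le_rpow haa'.le (by linarith) (by linarith)
  rw [eA, eT]
  calc (1 - t ^ k) * ((1 - a) * (1 - a) ^ (E - 1)) = ((1 - t ^ k) * (1 - a)) * (1 - a) ^ (E - 1) := by ring
    _ ≤ ((1 - a ^ k) * (1 - t)) * (1 - t) ^ (E - 1) :=
        mul_le_mul hc hmono (Real.rpow_nonneg haa'.le _) (by nlinarith)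
    _ = (1 - a ^ k) * ((1 - t) * (1 - t) ^ (E - 1)) := by ring


/-! ## The sign lemma `P ≤ 0` -/

/-- For `1 ≤ k ≤ 4` and `0 ≤ x ≤ 1`: `P(x) := 3x - (k-1) - (2k+1)·x^k + 3(k-1)·x^k·x ≤ 0`.
Proof: `P = B₁ - x^k B₂` with `B₁ = 3x-(k-1)`, `B₂ = (2k+1)-3(k-1)x ≥ 4-k ≥ 0`; if `B₁ > 0` and `k < 4`, the function
`G(y) = k·log y + log B₂(y) - log B₁(y)` is non-increasing on `[x,1]` (its derivative is `-k(k-1)·(9y²-3(k+2)y+(2k+1))/(y B₁ B₂)` and the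
quadratic has discriminant `9k(k-4) ≤ 0`) and vanishes at `1`, so `x^k B₂(x) ≥ B₁(x)`. [this work] -/
theorem P_nonpos {k x : ℝ} (hk1 : 1 ≤ k) (hk4 : k ≤ 4) (hx0 : 0 ≤ x) (hx1 : x ≤ 1) :
    3 * x - (k - 1) - (2 * k + 1) * x ^ k + 3 * (k - 1) * (x ^ k * x) ≤ 0 := by
  have hxk : 0 ≤ x ^ k := Real.rpow_nonneg hx0 k
  have hB2 : 0 ≤ (2 * k + 1) - 3 * (k - 1) * x := by nlinarith
  have eP : 3 * x - (k - 1) - (2 * k + 1) * x ^ k + 3 * (k - 1) * (x ^ k * x)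
      = (3 * x - (k - 1)) - x ^ k * ((2 * k + 1) - 3 * (k - 1) * x) := by ring
  rw [eP]
  by_cases hB1 : 3 * x - (k - 1) ≤ 0
  · nlinarith [mul_nonneg hxk hB2]
  rw [not_le] at hB1
  have hx : 0 < x := by nlinarith
  rcases eq_or_lt_of_le hk4 with hk | hk
  · -- `k = 4`: `P = (x-1)(3+9x^4)`
    subst hk
    nlinarith [mul_nonneg (sub_nonneg.2 hx1) (by positivity : (0:ℝ) ≤ 3 + 9 * x ^ (4:ℝ))]
  -- `k < 4`: the log argument on `[x, 1]`
  have hB2pos : ∀ y, y ≤ 1 → 0 < (2 * k + 1) - 3 * (k - 1) * y := by intro y hy; nlinarith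
  have hB1pos : ∀ y, x ≤ y → 0 < 3 * y - (k - 1) := by intro y hy; linarith
  set G : ℝ → ℝ := fun y => k * Real.log y + Real.log ((2 * k + 1) - 3 * (k - 1) * y) - Real.log (3 * y - (k - 1))
    with hG
  have hder : ∀ y ∈ Icc x 1, HasDerivAt G
      (k * y⁻¹ + (-(3 * (k - 1) * 1)) / ((2 * k + 1) - 3 * (k - 1) * y) - 3 * 1 / (3 * y - (k - 1))) y := by
    intro y hy
    have hy0 : 0 < y := hx.trans_le hy.1
    have h1 : HasDerivAt (fun y => k * Real.log y) (k * y⁻¹) y := (Real.hasDerivAt_log hy0.ne').const_mul k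
    have h2 : HasDerivAt (fun y => Real.log ((2 * k + 1) - 3 * (k - 1) * y))
        ((-(3 * (k - 1) * 1)) / ((2 * k + 1) - 3 * (k - 1) * y)) y :=
      (((hasDerivAt_id y).const_mul (3 * (k - 1))).const_sub (2 * k + 1)).log (hB2pos y hy.2).ne'
    have h3 : HasDerivAt (fun y => Real.log (3 * y - (k - 1))) (3 * 1 / (3 * y - (k - 1))) y :=
      (((hasDerivAt_id y).const_mul 3).sub_const (k - 1)).log (hB1pos y hy.1).ne'
    exact (h1.add h2).sub h3
  have hanti : AntitoneOn G (Icc x 1) := by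
    apply antitoneOn_of_deriv_nonpos (convex_Icc x 1)
    · intro y hy
      exact (hder y hy).continuousAt.continuousWithinAt
    · rw [interior_Icc]
      intro y hy
      exact (hder y ⟨hy.1.le, hy.2.le⟩).differentiableAt.differentiableWithinAt
    · rw [interior_Icc]
      intro y hy
      rw [(hder y ⟨hy.1.le, hy.2.le⟩).deriv]
      have hy0 : 0 < y := hx.trans hy.1
      have hb2 := hB2pos y hy.2.le
      have hb1 := hB1pos y hy.1.le
      have hq : 0 ≤ 9 * y ^ 2 - 3 * (k + 2) * y + (2 * k + 1) := by
        nlinarith [sq_nonneg (6 * y - (k + 2)), mul_nonneg (by linarith : (0:ℝ) ≤ k) (by linarith : (0:ℝ) ≤ 4 - k)]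
      have hnum : 0 ≤ k * (k - 1) * (9 * y ^ 2 - 3 * (k + 2) * y + (2 * k + 1)) :=
        mul_nonneg (mul_nonneg (by linarith) (by linarith)) hq
      have hden : 0 < y * (3 * y - (k - 1)) * ((2 * k + 1) - 3 * (k - 1) * y) := by positivity
      have hy0' : y ≠ 0 := hy0.ne'
      set B₁ : ℝ := 3 * y - (k - 1) with hB₁
      set B₂ : ℝ := (2 * k + 1) - 3 * (k - 1) * y with hB₂
      have hb1' : B₁ ≠ 0 := hb1.ne'
      have hb2' : B₂ ≠ 0 := hb2.ne'
      have e : k * y⁻¹ + (-(3 * (k - 1) * 1)) / B₂ - 3 * 1 / B₁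
          = -(k * (k - 1) * (9 * y ^ 2 - 3 * (k + 2) * y + (2 * k + 1))) / (y * B₁ * B₂) := by
        field_simp
        rw [hB₁, hB₂]
        ring
      rw [e, neg_div]
      exact neg_nonpos.2 (div_nonneg hnum hden.le)
  have hG1 : G 1 = 0 := by
    have e1 : (2 * k + 1) - 3 * (k - 1) * (1:ℝ) = 3 * 1 - (k - 1) := by ring
    simp only [hG, Real.log_one, mul_zero, zero_add, e1, sub_self]
  have hGx : 0 ≤ G x := by
    have := hanti (show x ∈ Icc x 1 from ⟨le_rfl, hx1⟩) (show (1:ℝ) ∈ Icc x 1 from ⟨hx1, le_rfl⟩) hx1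
    rw [hG1] at this
    exact this
  -- unpack `0 ≤ G x = log (x^k B₂ / B₁)`
  have hb1 := hB1pos x le_rfl
  have hb2 := hB2pos x hx1
  have hxkpos : 0 < x ^ k := Real.rpow_pos_of_pos hx k
  have eG : G x = Real.log (x ^ k * ((2 * k + 1) - 3 * (k - 1) * x) / (3 * x - (k - 1))) := by
    rw [Real.log_div (by positivity) hb1.ne', Real.log_mul hxkpos.ne' hb2.ne', Real.log_rpow hx]
  rw [eG] at hGx
  have h1le : 1 ≤ x ^ k * ((2 * k + 1) - 3 * (k - 1) * x) / (3 * x - (k - 1)) :=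
    (Real.log_nonneg_iff (by positivity)).1 hGx
  rw [le_div_iff₀ hb1] at h1le
  linarith

/-! ## Region II -/

/-- **Region II of the one-variable lemma.**  For `1 ≤ k ≤ 4` and `0 < a ≤ t < 1`:
`(1 - t^k)³ · a^{k-1} · (1-a)^{4-k} ≤ (1 - a^k)³ · t^{k-1} · (1-t)^{4-k}`, i.e. `N(y) = (1-y^k)³ / (y^{k-1}(1-y)^{4-k})` is non-increasing on
`(0,1)` — the derivative of `log N` is `P(y)/(y(1-y)(1-y^k)) ≤ 0` by `P_nonpos`. [this work] -/
theorem regionII {k a t : ℝ} (hk1 : 1 ≤ k) (hk4 : k ≤ 4) (ha0 : 0 < a) (hat : a ≤ t) (ht1 : t < 1) :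
    (1 - t ^ k) ^ 3 * (a ^ (k - 1) * (1 - a) ^ (4 - k)) ≤ (1 - a ^ k) ^ 3 * (t ^ (k - 1) * (1 - t) ^ (4 - k)) := by
  have hk0 : 0 < k := by linarith
  -- positivity facts on `[a, t] ⊆ (0,1)`
  have hpos : ∀ y ∈ Icc a t, 0 < y ∧ 0 < 1 - y ∧ 0 < 1 - y ^ k := by
    intro y hy
    have hy0 : 0 < y := ha0.trans_le hy.1
    have hy1 : y < 1 := hy.2.trans_lt ht1
    refine ⟨hy0, by linarith, ?_⟩
    have : y ^ k < 1 := Real.rpow_lt_one hy0.le hy1 hk0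
    linarith
  set F : ℝ → ℝ := fun y => 3 * Real.log (1 - y ^ k) - (k - 1) * Real.log y - (4 - k) * Real.log (1 - y) with hF
  have hder : ∀ y ∈ Icc a t, HasDerivAt F
      (3 * (-(k * y ^ (k - 1)) / (1 - y ^ k)) - (k - 1) * y⁻¹ - (4 - k) * (-(1:ℝ) / (1 - y))) y := by
    intro y hy
    obtain ⟨hy0, hy1, hyk⟩ := hpos y hy
    have h1 : HasDerivAt (fun y => 3 * Real.log (1 - y ^ k)) (3 * (-(k * y ^ (k - 1)) / (1 - y ^ k))) y :=
      (((Real.hasDerivAt_rpow_const (Or.inl hy0.ne')).const_sub 1).log hyk.ne').const_mul 3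
    have h2 : HasDerivAt (fun y => (k - 1) * Real.log y) ((k - 1) * y⁻¹) y :=
      (Real.hasDerivAt_log hy0.ne').const_mul (k - 1)
    have h3 : HasDerivAt (fun y => (4 - k) * Real.log (1 - y)) ((4 - k) * (-(1:ℝ) / (1 - y))) y :=
      (((hasDerivAt_id y).const_sub 1).log hy1.ne').const_mul (4 - k)
    exact (h1.sub h2).sub h3
  have hanti : AntitoneOn F (Icc a t) := by
    apply antitoneOn_of_deriv_nonpos (convex_Icc a t)
    · intro y hy
      exact (hder y hy).continuousAt.continuousWithinAt
    · rw [interior_Icc]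
      intro y hy
      exact (hder y ⟨hy.1.le, hy.2.le⟩).differentiableAt.differentiableWithinAt
    · rw [interior_Icc]
      intro y hy
      have hy' : y ∈ Icc a t := ⟨hy.1.le, hy.2.le⟩
      rw [(hder y hy').deriv]
      obtain ⟨hy0, hy1, hyk⟩ := hpos y hy'
      have hP := P_nonpos hk1 hk4 hy0.le (by linarith : y ≤ 1)
      have eyk : y ^ (k - 1) = y ^ k / y := by
        rw [Real.rpow_sub_one hy0.ne']
      have hden : 0 < y * (1 - y) * (1 - y ^ k) := by positivity
      have e : 3 * (-(k * y ^ (k - 1)) / (1 - y ^ k)) - (k - 1) * y⁻¹ - (4 - k) * (-(1:ℝ) / (1 - y))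
          = (3 * y - (k - 1) - (2 * k + 1) * y ^ k + 3 * (k - 1) * (y ^ k * y)) / (y * (1 - y) * (1 - y ^ k)) := by
        rw [eyk]
        field_simp
        ring
      rw [e]
      exact div_nonpos_of_nonpos_of_nonneg hP hden.le
  have hFle : F t ≤ F a := hanti ⟨le_rfl, hat⟩ ⟨hat, le_rfl⟩ hat
  -- unpack the logs at `a` and at `t`
  have eF : ∀ y ∈ Icc a t, F y = Real.log ((1 - y ^ k) ^ 3 / (y ^ (k - 1) * (1 - y) ^ (4 - k))) := by
    intro y hy
    obtain ⟨hy0, hy1, hyk⟩ := hpos y hy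
    have h1 : 0 < y ^ (k - 1) := Real.rpow_pos_of_pos hy0 _
    have h2 : 0 < (1 - y) ^ (4 - k) := Real.rpow_pos_of_pos hy1 _
    rw [Real.log_div (by positivity) (by positivity), Real.log_mul h1.ne' h2.ne', Real.log_pow,
      Real.log_rpow hy0, Real.log_rpow hy1]
    simp only [hF]
    push_cast
    ring
  rw [eF t ⟨hat, le_rfl⟩, eF a ⟨le_rfl, hat⟩] at hFle
  obtain ⟨ha0', ha1, hak⟩ := hpos a ⟨le_rfl, hat⟩
  obtain ⟨ht0, ht1', htk⟩ := hpos t ⟨hat, le_rfl⟩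
  have hDa : 0 < a ^ (k - 1) * (1 - a) ^ (4 - k) := by positivity
  have hDt : 0 < t ^ (k - 1) * (1 - t) ^ (4 - k) := by positivity
  have hle : (1 - t ^ k) ^ 3 / (t ^ (k - 1) * (1 - t) ^ (4 - k)) ≤ (1 - a ^ k) ^ 3 / (a ^ (k - 1) * (1 - a) ^ (4 - k)) :=
    (Real.log_le_log_iff (by positivity) (by positivity)).1 hFle
  rw [div_le_div_iff₀ hDt hDa] at hle
  linarith

end Summit.CriticalPhenomena.PercolationContinuityZ3.Theorems.SuperTerminalQuarticOneSided
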